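import Literature.NumberTheory.GaussSums.StickelbergerIdealClassGroupAnnihilation
import Literature.NumberTheory.NumberFields.ClassGroupNormGalois
import HarnessLib

/-!
# Herbrand's direction via Stickelberger, part B: the norm on class groups is equivariant for base-moving
# automorphisms, and Stickelberger's relation for `ℚ(μ_m)` pushes down to every subfield `E ⊆ ℚ(μ_m)`

Crux `stmt-BirchSwinnertonDyer-20372` (`PrintCFram.BottomClassIndexLawFiveLe`), line `eisenstein-resource-bdp-line`; part of
the discharge of the HERBRAND direction of `MazurWiles1984.thm2_*` (see part A,
`…HerbrandStickelbergerBernoulliSum.lean`). THEOREMS ONLY (no definition, no named fact, no `sorry`):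

* `intNorm_intAut`, `relNorm_map_intAut`, **`classGroupNorm_mulEquiv_intAut`** — for number fields `K ⊆ L` and automorphisms
  `τ` of `L`, `σ` of `K` with `τ|_K = σ`: `N_{L/K}(τ x) = σ(N_{L/K} x)` on integers, `N_{L/K}(τ𝔄) = σ(N_{L/K}𝔄)` on ideals,
  and `N_{L/K}(τ • c) = σ • N_{L/K}(c)` on ideal classes (Galois action `ClassGroup.mulEquiv (AmbiguousClass.intAut ·)`;
  the tree's `classGroupNorm_galois_smul` is the case `σ = 1`). Neukirch III (1.6)/(2.?) functoriality of the norm.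
* **`prod_mulEquiv_restrictNormal_classGroupNorm_pow_stickelberger_eq_one`** — STICKELBERGER PUSHED DOWN: for
  `M = ℚ(μ_m)` (in `Type`), a normal subfield `E` (`Algebra E M`, `Normal ℚ E`), every class `C` of `M` and every `b ∈ ℕ`:
  `Π_{σ ∈ Gal(M/ℚ)} ((σ|_E)⁻¹ • N_{M/E} C)^{⌊b·c(σ)/m⌋} = 1` in `Cl(𝓞 E)` — the norm image of the tree's Thm. 2.3 on classes
  (`JacobiSumIdeal.prod_mulEquiv_pow_stickelberger_eq_one`). This is the relation «`(b − σ_b)θ` annihilates the norm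
  classes of `E`» from which Stickelberger's theorem for an abelian field is deduced (Washington Thm. 6.10, proof; Lang Ch. 1
  §2 for `ℚ(μ_m)`).

BSD is not proved by any of this; no summit statement is proved here.
References: [Lang1990] Ch. 1 §2 Thm. 2.3; [Washington1997] §6.2 Thm. 6.10 (proof: passage from `ℚ(ζ_m)` to `K ⊆ ℚ(ζ_m)`
via the norm); [NeukirchANT1999] Ch. III §1 (1.6).
-/

noncomputable section

open NumberField IsDedekindDomain
open scoped nonZeroDivisors
open Literature.NumberTheory.NumberFields Literature.NumberTheory.NumberFields.AmbiguousClass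

set_option linter.dupNamespace false
set_option autoImplicit false

namespace Summit.BirchSwinnertonDyer.BirchSwinnertonDyer.Theorems.PrintCFram.HerbrandStickelberger

/-! ## §1 Equivariance of the norm under automorphisms moving the base -/

section Equivariance

variable (K L : Type) [Field K] [NumberField K] [Field L] [NumberField L] [Algebra K L]
  {F F' : Type*} [Field F] [Field F'] [Algebra F L] [Algebra F' K]

/-- **`N_{L/K}(τ x) = σ(N_{L/K} x)` on integers** for an automorphism `τ` of `L` restricting to the automorphism `σ` of `K`
(`τ ∘ i = i ∘ σ`): the integral norm `Algebra.intNorm (𝓞 K) (𝓞 L)` is equivariant (Mathlib `Algebra.norm_eq_of_equiv_equiv` on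
the fields, `Algebra.algebraMap_intNorm`). [cite: NeukirchANT1999, Ch. III §1 (1.6) (ii)–(iv) (functoriality of the relative norm)] -/
theorem intNorm_intAut (τ : L ≃ₐ[F] L) (σ : K ≃ₐ[F'] K)
    (hτ : ∀ x : K, τ (algebraMap K L x) = algebraMap K L (σ x)) (x : 𝓞 L) :
    Algebra.intNorm (𝓞 K) (𝓞 L) (intAut τ x) = intAut σ (Algebra.intNorm (𝓞 K) (𝓞 L) x) := by
  apply FaithfulSMul.algebraMap_injective (𝓞 K) K
  rw [Algebra.algebraMap_intNorm (A := 𝓞 K) (K := K) (L := L) (B := 𝓞 L)]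
  change Algebra.norm K (τ (x : L)) = ((σ : K ≃ₐ[F'] K) ((Algebra.intNorm (𝓞 K) (𝓞 L) x : 𝓞 K) : K))
  rw [show ((Algebra.intNorm (𝓞 K) (𝓞 L) x : 𝓞 K) : K) = Algebra.norm K (x : L) from
    Algebra.algebraMap_intNorm (A := 𝓞 K) (K := K) (L := L) (B := 𝓞 L) x]
  have he : (algebraMap K L).comp (σ.toRingEquiv : K →+* K) =
      (τ.toRingEquiv : L →+* L).comp (algebraMap K L) := by
    ext y; exact (hτ y).symm
  rw [Algebra.norm_eq_of_equiv_equiv σ.toRingEquiv τ.toRingEquiv he (x : L)]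
  simp

/-- **`N_{L/K}(τ𝔄) = σ(N_{L/K} 𝔄)` on integral ideals** (Mathlib `Ideal.relNorm (𝓞 K)`; images along `intAut`).
[cite: NeukirchANT1999, Ch. III §1 (1.6)] -/
theorem relNorm_map_intAut (τ : L ≃ₐ[F] L) (σ : K ≃ₐ[F'] K)
    (hτ : ∀ x : K, τ (algebraMap K L x) = algebraMap K L (σ x)) (J : Ideal (𝓞 L)) :
    Ideal.relNorm (𝓞 K) (J.map (intAut τ : 𝓞 L →+* 𝓞 L)) =
      (Ideal.relNorm (𝓞 K) J).map (intAut σ : 𝓞 K →+* 𝓞 K) := by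
  apply le_antisymm
  · rw [Ideal.relNorm_apply, Ideal.span_le]
    rintro _ ⟨y, hy, rfl⟩
    rw [SetLike.mem_coe, Ideal.mem_map_iff_of_surjective (intAut τ : 𝓞 L →+* 𝓞 L)
      (intAut τ).surjective] at hy
    obtain ⟨x, hx, rfl⟩ := hy
    rw [SetLike.mem_coe, RingHom.coe_coe, intNorm_intAut K L τ σ hτ]
    exact Ideal.mem_map_of_mem _ (Ideal.intNorm_mem_spanNorm (𝓞 K) hx)
  · rw [Ideal.map_le_iff_le_comap, Ideal.relNorm_apply, Ideal.span_le]
    rintro _ ⟨x, hx, rfl⟩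
    rw [SetLike.mem_coe, Ideal.mem_comap, RingHom.coe_coe, ← intNorm_intAut K L τ σ hτ]
    exact Ideal.intNorm_mem_spanNorm (𝓞 K) (Ideal.mem_map_of_mem _ hx)

/-- **`N_{L/K}(τ • c) = σ • N_{L/K}(c)` on ideal classes** for `τ ∈ Aut(L)` restricting to `σ ∈ Aut(K)`, the actions being
`ClassGroup.mulEquiv (intAut ·)` (the tree's Galois action on class groups; `classGroupNorm_galois_smul` is the case
`σ = 1`). [cite: NeukirchANT1999, Ch. III §1 (1.6)] [cite: Lang1990, Ch. 3 §4 (the norm map on ideal class groups)] -/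
theorem classGroupNorm_mulEquiv_intAut (τ : L ≃ₐ[F] L) (σ : K ≃ₐ[F'] K)
    (hτ : ∀ x : K, τ (algebraMap K L x) = algebraMap K L (σ x)) (c : ClassGroup (𝓞 L)) :
    classGroupNorm K L (ClassGroup.mulEquiv (intAut τ) c) =
      ClassGroup.mulEquiv (intAut σ) (classGroupNorm K L c) := by
  classical
  obtain ⟨J, rfl⟩ := ClassGroup.mk0_surjective c
  rw [mulEquiv_mk0, classGroupNorm_mk0, classGroupNorm_mk0, mulEquiv_mk0]
  congr 1
  exact Subtype.ext (relNorm_map_intAut K L τ σ hτ J)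

end Equivariance

/-! ## §2 Stickelberger's relation pushed down to a subfield of `ℚ(μ_m)` -/

section Pushdown

variable {m : ℕ} [NeZero m] (M : Type) [Field M] [NumberField M] [IsCyclotomicExtension {m} ℚ M]
  (E : Type) [Field E] [NumberField E] [Algebra E M] [Normal ℚ E] [IsScalarTower ℚ E M]

/-- **Stickelberger's theorem for `ℚ(μ_m)`, pushed down by the norm to a normal subfield `E`**: for every ideal class `C`
of `M = ℚ(μ_m)` and every `b ∈ ℕ`, `Π_{σ ∈ Gal(M/ℚ)} ((σ|_E)⁻¹ • N_{M/E} C)^{⌊b·c(σ)/m⌋} = 1` in `Cl(𝓞 E)`, where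
`σ ζ = ζ^{c(σ)}` (`Rat.galEquivZMod`), `σ|_E = AlgEquiv.restrictNormalHom E σ`. The norm image of Thm. 2.3
(`JacobiSumIdeal.prod_mulEquiv_pow_stickelberger_eq_one`) by the equivariance `N(σ⁻¹ • C) = (σ|_E)⁻¹ • N(C)`.
[cite: Lang1990, Ch. 1 §2 Thm. 2.3] [cite: Washington1997, §6.2 Thm. 6.10 (proof)] -/
theorem prod_mulEquiv_restrictNormal_classGroupNorm_pow_stickelberger_eq_one (b : ℕ) (C : ClassGroup (𝓞 M)) :
    ∏ σ : M ≃ₐ[ℚ] M, (ClassGroup.mulEquiv (intAut (AlgEquiv.restrictNormalHom E σ)⁻¹)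
        (classGroupNorm E M C)) ^ (b * ((IsCyclotomicExtension.Rat.galEquivZMod m M σ : (ZMod m)ˣ) : ZMod m).val / m) =
      1 := by
  have h := Literature.NumberTheory.GaussSums.JacobiSumIdeal.prod_mulEquiv_pow_stickelberger_eq_one
    (m := m) (M := M) b C
  apply_fun classGroupNorm E M at h
  rw [map_prod, map_one] at h
  rw [← h]
  refine Finset.prod_congr rfl fun σ _ => ?_
  rw [map_pow, ← map_inv, classGroupNorm_mulEquiv_intAut E M σ⁻¹ (AlgEquiv.restrictNormalHom E σ⁻¹)]
  intro x
  exact (AlgEquiv.restrictNormal_commutes σ⁻¹ E x).symm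

end Pushdown

end Summit.BirchSwinnertonDyer.BirchSwinnertonDyer.Theorems.PrintCFram.HerbrandStickelberger

end
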